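import Mathlib
import HarnessLib
import HarnessLib.Audit
import Summits.BirchSwinnertonDyer.Statement
import HarnessLib.Audit.Check
import Literature.NumberTheory.EllipticCurves.Selmer
import Literature.NumberTheory.EllipticCurves.Sha
import Literature.NumberTheory.EllipticCurves.GlobalMinimalModel
import Literature.NumberTheory.EllipticCurves.GaloisAction
import Literature.NumberTheory.EllipticCurves.OrdinaryPrimes
import Literature.NumberTheory.EllipticCurves.Newforms
import Literature.NumberTheory.DiophantineGeometry.Conductor
import Literature.NumberTheory.EllipticCurves.SelmerCorankHolds
import Literature.NumberTheory.EllipticCurves.GlobalMinimalModelProofs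
import Literature.NumberTheory.EllipticCurves.OrdinaryPrimesProofs
import Literature.NumberTheory.EllipticCurves.MinimalModelReduction
import Literature.NumberTheory.EllipticCurves.VariableChangePoints
import Literature.NumberTheory.DiophantineGeometry.LocalReductionProofs
import Literature.NumberTheory.DiophantineGeometry.MinimalModelUniquenessProofs
import Summits.BirchSwinnertonDyer.BirchSwinnertonDyer.Theorems.SelmerRankAssembly
import Summits.BirchSwinnertonDyer.BirchSwinnertonDyer.Theorems.SelmerRankShaCorank
import Literature.NumberTheory.EllipticCurves.ZpExtension
import Literature.NumberTheory.EllipticCurves.PAdicBSD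
import Literature.NumberTheory.EllipticCurves.CuspFormLFunction
import Literature.NumberTheory.EllipticCurves.IwasawaSelmer
import Literature.NumberTheory.EllipticCurves.IwasawaAlgebra
import Literature.NumberTheory.EllipticCurves.PAdicLFunction
import Literature.NumberTheory.EllipticCurves.Isogeny
import HarnessLib.Audit.Status.Attr

/-!
Route: TangentCone

# Route TangentCone — the rank as the total order of the two-variable p-adic L at (2,1), read
period-free on edge critical values of the Hida family

RESURRECT (lens 3.9, cycle 1): the earlier programme's route
summits/bsd/routes/two-variable-tangent-cone (STATUS proving, paper v6, four reviews all returned on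
ONE normalisation seam; work/LINE.md, CENSUS.md C1–C5) with its sibling hida-central-line (upheld),
re-typed crux-only and PERIOD-FREE into today's Statement. It suffices to show X = (EDGE ∧ CAP) ∧
(LB-side): (EDGE, crux EdgeDecay = the 2001 'total exact order' TEO_p) for every elliptic E/ℚ of
analytic rank r ≥ 2 that has one big-image good ordinary prime ≥ 5 (non-CM proxy) there are an
ADMISSIBLE prime p (good ordinary, a_p² ≢ 1, ρ̄ surjective, and f_E p-adically ISOLATED among
ordinary weight-2 eigensystems of level dividing N·p — hypothesis (Br), 𝕋_𝔪 ≅ Λ) and a rational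
slope λ = a/b < 1/2 such that along the classical points of the line s − 1 = λ(k − 2) through (k,s)
= (2,1) the critical-value RATIOS R_k = Λ(g_k, s_k)/Λ(g_k, j) (j odd ≤ 2J+1, Λ = completed L-value =
tree `completedLValue`) of the ordinary newforms g_k ∈ S_k(Γ₀(N_E)) congruent to f_E decay
p-adically NO FASTER than r: v_p(ι R_k) ≤ r·(m+1) + C whenever p^m ∣ k − 2 — i.e. the two-variable
Mazur–Kitagawa p-adic L-function L_p(f_∞; k, s) vanishes at (2,1) to TOTAL ORDER ≤ r
(Greenberg–Stevens' 1993 degree question), a statement about NON-VANISHING edge critical values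
only; (CAP, crux EdgeCap = 2001 Thm B + Thm C in ratio form) at every admissible p the same ratios
decay AT LEAST at the rate corank_ℤ_p Sel_p∞(E/ℚ): v_p(ι R_k) ≥ s_p·(1 + v_p(k−2)) − C (Ochiai's
two-variable Euler-system divisibility + Nekovář control give s_p ≤ n_p ≤ ν_λ, and the order ν_λ is
read off valuations). EDGE ∧ CAP squeeze s_p ≤ r at ONE prime; (LB-side) r ≤ s_p, Ш[p^∞] finite and
the small-image sector are the cruxes SelmerRankLB / SelmerRankShaPFinite / SelmerRankSmallImage
shared VERBATIM with routes SelmerRank / ToricShedding / FrozenTwin, and analytic rank ≤ 1 is the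
Gross–Zagier–Kolyvagin leaf RankLeOne. No card realised (the sub's card index has no Hida-family /
weight-variable card).
Lean: `EdgeDecay → EdgeCap → SelmerRankLB → SelmerRankShaPFinite → SelmerRankSmallImage → RankLeOne
→ _root_.BirchSwinnertonDyer`

## Assembly
Bookkeeping over proved tree theorems, ALL inside the crux-only deciding theorem (folder
SketchGlue.lean: lean check rc 0, 0 sorries, axioms propext / Classical.choice / Quot.sound):
`closes : EdgeDecay → EdgeCap → SelmerRankLB → SelmerRankShaPFinite → SelmerRankSmallImage →
RankLeOne → BirchSwinnertonDyer`. For an arbitrary elliptic W take a global minimal model V = C • W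
(hasGlobalMinimalModel_rat_holds). If r_an(V) ≤ 1, RankLeOne gives rank = r_an. Else take a good
ordinary p₀ ≥ 5 (exists_good_ordinary_prime_holds); if ρ̄_p₀ is not surjective, SelmerRankSmallImage
gives corank = r_an at p₀; if it is, EdgeDecay supplies (p, (Br), a, b) and, for the J of EdgeCap at
(p, a, b), a constant C₂ and for every m a branch member (k, g, ι, s) with p^m ∣ k − 2 whose ratios
satisfy 1 ≤ ‖ιR‖·p^(r(m+1)+C₂) for all odd j ≤ 2J+1, while EdgeCap gives j and
‖ιR‖·p^(s_p(1+v_p(k−2))) ≤ p^C₁; since m ≤ v_p(k−2) (padicValInt_dvd_iff) this is s_p(1+m) ≤ r(m+1)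
+ C₁ + C₂ for every m, hence s_p ≤ r (take m = C₁ + C₂), and SelmerRankLB gives corank = r_an at p.
Then SelmerRankShaPFinite and shaCorank_eq_zero_of_finite with Greenberg's identity
selmerCorank_eq_mordellWeilRank_add_holds give rank V = r_an V, and isomorphism invariance of rank /
local Euler factors / analytic rank (re-derived inline exactly as in route FrozenTwin's certified
closes: VariableChange.finrank_point_variableChange, minimal models, AEC VII / App. C §16)
transports to W.

Rationale: WHY THIS LINE. Mechanism (GreenbergStevens1993 closing question p. 413; Delbourgo2008 Ch. VII–X; the
2001 accumulator, never assembled to RANK there): the total order n_p(E) of L_p(f_∞; k, s) at (2,1)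
is the WEAKEST p-adic exact-order statement that still caps the Selmer corank — it is at most the
order along ANY line through (2,1), so it is implied by the Mazur–Tate–Teitelbaum order conjecture
on the cyclotomic line (route PAdicOrderV2's hard half) but does not imply it; on the algebraic side
(Venerucci thesis Thm 12.13 / Venerucci2015, Nekovar2006 §11) its leading form is u·#Ш·det(κ⟨,⟩^Nek
+ (σ−κ/2)⟨,⟩^MTT), so what n_p = r needs is non-degeneracy of SOME member of a PENCIL of p-adic
pairings (rank 2: (Pf⟨P,Q⟩^Nek, det⟨,⟩^MTT) ≠ (0,0)), not Schneider's conjecture (the member (0:1));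
and in the weight direction first derivatives are LOGARITHMS of global points (BertoliniDarmon2007:
d²/dk² L_p(k,k/2) = log_E(P)², automatically ≠ 0), not heights. Off the cyclotomic line the
interpolated quantities are the edge critical values L(g_k, s), 1 ≤ s < k/2, of the higher-weight
members, which never vanish, so n_p becomes a p-adic GROWTH RATE of non-zero algebraic numbers —
typed here as ratios Λ(g_k,s)/Λ(g_k,j) ∈ K_g (Eichler–Shimura–Manin rationality, a tree THEOREM:
IsNewform0.criticalValues_petersson_mem_coeffField), which makes the p-adic period, the canonical
complex period and every Λ-adic unit CANCEL: exactly the Kitagawa↔modular-symbol normalisation seam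
on which the 2001 paper's v1, v3, v4, v5 were returned disappears from the statements, and vertical
divisors of the two-variable function cancel too. Imported areas: Hida theory / Λ-adic modular
symbols (Hida1986, GreenbergStevens1993, Kitagawa1994 zbl:0841.11028, EmertonPollackWeston2005),
Euler systems in families (Ochiai2005, Ochiai2006, Delbourgo2008), Selmer complexes and p-adic
weight pairings (Nekovar2006, Venerucci2015, BertoliniEtAl2022), period rationality (PasolPopa2013).
What no listed route does: PAdicOrderV2 compares the CYCLOTOMIC order with r_an (Schneider at both
ends), LeadingTerm files a leading-COEFFICIENT identity, ToricShedding / FrozenTwin read depth in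
the level-raising resp. class-group direction, HigherGrossZagier constructs points, SelmerRank /
Squeeze are frames, ShadowIsolation uses accidental zeros of congruent WEIGHT-2 forms — none varies
the WEIGHT; here the order is measured vertically, by how fast the edge values of the congruent
higher-weight forms decay. Negatives index (1 entry, LeadingTerm TamePinch: CM curves have no
admissible p) is steered around: EdgeDecay is conditional on the existence of one big-image good
ordinary prime, CM / small-image curves sit in SelmerRankSmallImage.

RANKED CRUXES. #2 EdgeDecay (crux) — EDGE DECAY ≤ ANALYTIC RANK (2001 TEO_p, period-free). For every
elliptic E/ℚ (globally minimal W) with ord_(s=1) L(E,s) ≥ 2 and at least one big-image good ordinary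
prime ≥ 5: there are an admissible p (p ≥ 5 good ordinary, a_p² ≢ 1 mod p, ρ̄_(E,p) surjective,
(Br): every ordinary p-adic eigensystem of a weight-2 newform of level M ∣ N_E·p congruent to E away
from N_E·p is f_E's own) and a slope a/b ∈ [0, 1/2) such that for every J there is C with: for every
m there are k ≡ 2 mod 2b(p−1)p^m, k ≥ 2J+3, the point s = 1 + a(k−2)/b, an ordinary newform g ∈
S_k(Γ₀(N_E)) with a p-adic embedding ι of its coefficient field congruent to E (the Hida-branch
member), and for every odd j ∈ [3, 2J+1] the ratio R = Λ(g,s)/Λ(g,j) ∈ K_g satisfies ‖ι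
R‖·p^(r_an·(m+1)+C) ≥ 1 — the two-variable p-adic L-function of the Hida family vanishes at (2,1) to
total order ≤ r_an (Greenberg–Stevens predict = r_an). [difficulty: open-problem] (why it might
fail: Given the two-variable IMC it is ⟺ Ш[p^∞]-cotorsion ∧ non-degeneracy of SOME pencil member
κ⟨,⟩^Nek+(σ−κ/2)⟨,⟩^MTT at one admissible p — a Schneider-type (p-adic transcendence) statement,
known in no rank ≥ 2 case; a side condition ((Br), depth, slope parity) may be mis-typed.)
[GreenbergStevens1993, Delbourgo2008, Venerucci2015, BertoliniDarmon2007, Ochiai2006,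
EmertonPollackWeston2005,
docs/m5/inspiration/BirchSwinnertonDyer/BirchSwinnertonDyer/bsd-two-variable-tangent-cone.md]
#3 EdgeCap (crux) — EDGE VALUES CAP THE SELMER CORANK (2001 two-variable-tangent-cone Thm B + Thm C
= unpublished-internal-dependency, declared as a crux; ratio form). For every elliptic E/ℚ (globally
minimal W), every admissible p as in EdgeDecay and every slope a/b < 1/2 there are J, C such that
for every k ≡ 2 mod 2b(p−1) with k ≥ 2J+3, s = 1 + a(k−2)/b, every ordinary newform g ∈ S_k(Γ₀(N_E))
with a congruent p-adic embedding ι (the branch member, by (Br)), SOME odd j ∈ [3, 2J+1] has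
‖ι(Λ(g,s)/Λ(g,j))‖·p^(s_p·(1+v_p(k−2))) ≤ p^C, s_p = corank_ℤ_p Sel_p∞(E/ℚ): the edge ratios decay
at least at rate s_p. Intended proof: Greenberg–Stevens/Kitagawa two-variable L_p of the branch (𝕋_𝔪
≅ Λ by (Br)); interpolation at (k,s) and (k,j) with the SAME p-adic period (ratio kills periods and
Λ-adic units; vertical divisors cancel); Ochiai's divisibility char X ∣ L_p and control s_p ≤ n_p
(2001 Thm C: (H1), (Br), −1 ∈ im ρ̄, transvection); n_p ≤ order along the curve (1+σ) = (1+κ)^λ;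
order ⇒ valuation growth ≥ n_p·(1+v_p(k−2)) + μ uniformly (Weierstrass preparation); reference j by
compactness of weight space (the σ_j are infinitely many distinct points of the closed disc, so
max_j≤2J+1 |G₁(κ,σ_j)| is bounded below on the disc once G₁ has no vertical divisor); a_p² ≢ 1 keeps
the improved Euler factor (1 − a_p(κ)⁻¹) a unit on the vertical line (a = 0). [difficulty: XL] (why
it might fail: Ochiai's divisibility needs a UNIT transvection in im ρ_𝕋: printed from a Steinberg
prime ℓ, p ∤ ord_ℓ Δ (2001 Thm C (H4)); for integral-j curves only big-image theorems (Hida 2015),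
removal unproved; control/pseudo-null at (2,1) and the typed (Br)/depth/parity side conditions may
be mis-stated.) [Ochiai2005, Ochiai2006, GreenbergStevens1993, Delbourgo2008, Nekovar2006,
EmertonPollackWeston2005, Hida1986, Kato2004Asterisque, PasolPopa2013,
docs/m5/inspiration/BirchSwinnertonDyer/BirchSwinnertonDyer/bsd-two-variable-tangent-cone.md]
#4 SelmerRankLB (crux) — shared verbatim with routes SelmerRank / ToricShedding / FrozenTwin: for p
≥ 5 good ordinary with ρ̄_(E,p) surjective (global minimal model), ord_(s=1) L(E,s) ≤ corank_ℤ_p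
Sel_p∞(E/ℚ) (the supply half at the tangent-cone prime). [difficulty: open-problem] (why it might
fail: Theorem for r_an ≤ 3 (BCS2025 1.1.2, BurungaleEtAl2026 Cor 1, p-parity); OPEN from r_an = 4:
needs Selmer classes out of high-order vanishing; the tangent cone gives only UPPER bounds.)
[BurungaleEtAl2026, SkinnerUrban2014, Kato2004Asterisque, arXiv:2412.20078]
#5 SelmerRankShaPFinite (crux) — shared verbatim with routes SelmerRank / ToricShedding /
FrozenTwin: Ш(E/ℚ)[p^∞] is finite for every elliptic E/ℚ and every prime p (turns corank = r_an at
the tangent-cone prime into rank = r_an). [difficulty: open-problem] (why it might fail: Known only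
for r_an ≤ 1 (Kolyvagin1990, Kato2004Asterisque Thm 14.2); for r_an ≥ 2 nothing excludes an
infinitely divisible element of Ш at every p; far stronger than the one-prime cotorsion the glue
consumes.) [Kolyvagin1990, Kato2004Asterisque, GreenbergLNM1716]
#6 SelmerRankSmallImage (crux) — shared verbatim with routes SelmerRank / ToricShedding /
FrozenTwin: for E/ℚ (globally minimal W) and p ≥ 5 good ordinary with ρ̄_(E,p) NOT surjective (every
such p for a CM curve; finitely many for non-CM), corank_ℤ_p Sel_p∞(E/ℚ) = ord_(s=1) L(E,s) — the
sector the deciding theorem uses when the supplied good ordinary prime has small image (CM curves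
included). [difficulty: open-problem] (why it might fail: Open from min(corank, r_an) ≥ 2 as UB/LB;
Eisenstein p has IMC/μ = 0 only in the GreenbergVatsal2000 / CGLS cases, CM has Rubin's two-variable
IMC but no link to r_an ≥ 2.) [GreenbergLNM1716, Serre1972, SkinnerUrban2014, BurungaleEtAl2026]
#9 RankLeOne (support) — literature leaf (Gross–Zagier–Kolyvagin, Darmon2004 Thm 3.22): ord_(s=1)
L(E,s) ≤ 1 ⇒ rank_ℤ E(ℚ) = ord_(s=1) L(E,s) and Ш(E/ℚ) finite — verbatim the body of the tree fact
Literature.NumberTheory.EllipticCurves.rank_eq_analyticRank_of_analyticRank_le_one; analytic rank ≤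
1 never enters EdgeDecay (where it would be Schneider's conjecture in rank one). [difficulty: XL]
[GrossZagier1986, Kolyvagin1990, Darmon2004]

TWO-LAYER PLAN. Foreseen, not filed (birth skeletons in folder bc/): EdgeDecay ⇐
AdmissiblePrimeSupply (non-CM ⇒ a good ordinary, non-anomalous, big-image prime with (Br):
congruence primes are sparse — Ribet1990 level-lowering ⇔ p ∣ ord_ℓ Δ, modular degree, a_p = ±1
Lang–Trotter-sparse) → DecayAtEveryAdmissiblePrime (Greenberg–Stevens' degree prediction at every
admissible p, ratio form) → EdgeDecay (proved composition, bc/EdgeDecay_birth.lean). EdgeCap ⇐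
CapWithSteinbergTransvection (the printed (H4) case: a multiplicative ℓ with p ∤ ord_ℓ Δ) →
CapWithoutSteinbergTransvection (integral-j / p ∣ ord_ℓ Δ sector: transvection from big image in the
family) → EdgeCap (proved case split, bc/EdgeCap_birth.lean). Depth 1, k = 2 each. A later REGIME
split of EdgeDecay by slope: the vertical line a = 0 (improved L-function L_p^*, GS Prop 5.8) versus
generic a/b.

KILL CRITERIA. EdgeCap refuted at a typed side condition ⇒ misstated: repair by restating (the
mathematics is Ochiai + control + GS); refuted SUBSTANTIVELY (a branch member whose edge ratios
decay slower than s_p at an admissible p) would contradict the two-variable main conjecture's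
divisibility — close `refuted:EdgeCap` and record the witness as a barrier. EdgeDecay refuted for
one curve (edge ratios provably decaying faster than r_an at EVERY admissible p and slope) = the
pencil is degenerate at every p: close `refuted:EdgeDecay` (the tangent cone carries no more
information than the cyclotomic line). A refutation of SelmerRankLB / ShaPFinite / SmallImage breaks
this route together with SelmerRank / ToricShedding / FrozenTwin (shared items). Mooted (superseded)
if BirchSwinnertonDyer closes via PAdicOrderV2 (cyclotomic order) — TEO is implied by its Comparison
crux.

NOT DECOMPOSED YET. The two-variable p-adic L-function itself (no Lean object: it lives inside the
proofs of EdgeCap / EdgeDecay, never in a statement — definition request D1 below is for the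
provers' convenience, not blocking); the pencil non-degeneracy / weight-direction p-adic
Gross–Zagier in rank 2 (Pf⟨P,Q⟩^Nek ≠ 0: BertoliniDarmon2007 is rank 1 exceptional,
BertoliniEtAl2022 diagonal classes give rank-2 leading terms as log-regulators) — the real content
of EdgeDecay, to be split only after a crux-ideate pass; the CM / Eisenstein sector (inside
SelmerRankSmallImage, shared); analytic rank ≥ 4 supply (inside SelmerRankLB, shared); p ∈ {2, 3}
never needed. Import cone (route-repair 2026-08-17, cone guardrail): needs-fact:
WeierstrassCurve.hasEntireLFunction_rat — the one unproved named fact of the route's 76-module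
import cone is STATEMENT-BORNE (Theses.TangentCone → Summits.BirchSwinnertonDyer.Statement →
…/BirchSwinnertonDyer/Statement.lean → Literature.NumberTheory.EllipticCurves.AnalyticRank:
`analyticRank` is the order at 1 of `entireLFunction`, which is L(E,s) only under
HasEntireLFunction), genuinely needed (every item speaks of W.analyticRank) and not re-routable by
any route of this summit; in tree it is reduced sorry-free to modularity
`Literature.NumberTheory.EllipticCurves.ModularForms.exists_isNewformOf`
(WeierstrassCurve.hasEntireLFunction_rat_of_exists_isNewformOf, AnalyticRankModularityProofs; BCDT
chain in AnalyticRankBCDTTheoremBProofs) — the tier-0 debt is modularity (XL). The gate's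
used-constants cone is clean (0 unproved / 96 constants, closes native-OK). Latent and NOT needed:
Literature.NumberTheory.EllipticCurves.ModularForms.IsNewform1.finiteDimensional_coeffField
(Newforms.lean, Γ₁ coefficient field is a number field) sits in the same cone only because EdgeDecay
/ EdgeCap import `Newforms` for the Γ₀ notions IsNewform0 / coeffField / coeff_mem_coeffField; no
item or glue uses it, and it is a one-line `_holds` away from landed theorems
(`IsNewform1.finiteDimensional_coeffField_of_span_integralLattice1
(DeligneSerre1974_span_integralLattice1_holds N k)`, elaborated in the planner folder
scratch/Gamma1CoeffField.lean, lean check rc 0) — librarian / provefact hint, not a route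
dependency.

CHEAPEST FALSIFIER. Lookup (run 2026-08-17, zbMATH + held Delbourgo2008 + galaxy): no theorem or
counterexample on the Greenberg–Stevens degree at (2,1) beyond rank 0 (GS93 Thm 7.1) and the
exceptional rank-1 central-line formula (BertoliniDarmon2007); Delbourgo2008 Conj. 7.19 / Ch. X
treats only the leading TERMS given the orders. Next cheapest (kit/PARI job, first job of the route,
not run on the compute-free hub this cycle): recompute the 2001 Cor D table in RATIO form — for
(389a1, p=7, k=8), (571b1, 5, 10), (709a1, 5, 10): mfinit([N,k]), locate the newform orbit congruent
to f_E above p, Λ(g,1)/Λ(g,3) via mfsymbol periods, and check v_𝔭 = 2·(1+v_p(k−2)) − O(1) against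
rank 2 (2001 found E_k = 2 = rank for 22 of 27 pairs, never an undershoot in 3797 + 3859 twist
pairs); an undershoot v_𝔭(R) < rank·(1+v_p(k−2)) − C growing in depth would refute EdgeCap at that
(E,p).

NUMBERS. GreenbergStevens1993 Thm 7.1: rank 0, linear term of L_p(k,s) at (2,1) (n_p = 0 ⟺ L(E,1) ≠
0 at good ordinary p). 2001 two-variable-tangent-cone (paper v6, CLAIMS 2026-08-07/08): Cor D — n_p
= 2 = rank = corank and Ш[p^∞] finite for 27 certified pairs (rank 2, N < 1000, p ≤ 23; sharp for
22) from ONE weight-(p+1) edge value each; 198 rank-2 and 6 rank-3 quadratic twists; seven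
split-multiplicative pairs with n_p = ν_p = r + 1; 7656 twist pairs with 0 undershoots; Thm F:
tangent cones of (389a1,7) (two ℚ₇-rational lines θ = 2 + 7 + 2·7² + O(7³), 1 − θ), (571b1,5),
(709a1,5). Delbourgo2008 Thm 0.4: the vertical Selmer group is Λ^wt-cotorsion over every abelian F.
EmertonPollackWeston2005: μ, λ constant on Hida branches with 𝕋_𝔪 Gorenstein.

DEFINITION REQUESTS. D1 (not blocking): `mazurKitagawaLFunction W p : MvPowerSeries (Fin 2) ℤ_[p]` —
the Greenberg–Stevens / Kitagawa two-variable p-adic L-function of the Hida branch through f_W at an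
admissible p, with its interpolation at classical (k, s) (GreenbergStevens1993 Thm 5.15) and
cyclotomic specialisation = Literature.padicLFunction; topic Literature/NumberTheory/EllipticCurves.
D2 (not blocking): the ordinary Λ-adic Hecke algebra 𝕋_𝔪 of tame level N for GL₂/ℚ and the predicate
𝕋_𝔪 ≅ Λ (the tree's HidaHeckeAlgebraGLn is the adelic GL_n version), so that (Br) can be replaced by
its printed form. Facts (route-repair 2026-08-17): needs-fact:
WeierstrassCurve.hasEntireLFunction_rat (Statement-borne, see NOT DECOMPOSED YET; 0 imports
droppable — every import is required by an item signature or by `closes`,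
Theorems.SelmerRankAssembly being fact-free and inside the Statement+Selmer cone — and 0 cruxes
restated: newness of g is load-bearing in (Br), so EdgeDecay / EdgeCap keep `Newforms`).

Novelty: Searches (2026-08-17): `lit search` local daemon unavailable (connection reset, 3 tries) and
OpenAlex/S2/arXiv rate-limited (HTTP 429) — recorded; `lit search --source zbmath "Hida family
p-adic L-function vanishing weight"` (6 hits: Howard2007 central derivatives, Hida 2014 Duke,
Burungale 2017, Mok 2011, BSV 2021 Milan J., Mok 2012); `lit vsearch "order of vanishing of the
two-variable p-adic L-function of a Hida family at (2,1) equals the rank"` (12: Delbourgo2008 pp.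
13/101/34/211 top); `lit galaxy search "two-variable p-adic L-function" --star all` (18 rows: Hida
EMI, Ochiai Iwasawa book, Delbourgo LMS 356, Bellaïche Eigenbook, Rosso thesis (GS for Sym²), DHHJPR
OMS families, Bellaïche–Pollack μ-invariants); `lit read book:delbourgo2008` pp. 12, 100–101,
209–213 (vertical line, Thm 0.4, Conj. 7.5/7.18/7.19, improved L-function Def. 4.13); `lean search`
for padicLFunction / Hida / IsNewform0 / coeffField / completedLValue / PadicAlgCl (typing); ledger
negatives (1 entry); the 2001 archive route two-variable-tangent-cone (brief, CLAIMS, LINE, CENSUS,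
referee-notes, paper Thm B/C/D/E) and hida-central-line brief; all 8 open Theses of the sub.
Nearest prior art found: GreenbergStevens1993 (p. 413: the degree/tangent-cone QUESTION, rank-0
linear term Thm 7.1); Delbourgo2008 (doi:10.1017/cbo9780511721281, Ch. VII–X: vertical /
half-twisted Selmer groups, Λ-adic Euler characteristics, Conj. 7.19 — leading terms GIVEN the
orders, no comparison with r_an); Ochiai2006 (two-variabl  [refs: 10.1017/cbo9780511721281, book:delbourgo2008, doi:10.1017/cbo9780511721281, Howard2007, Delbourgo2008, GreenbergStevens1993, Ochiai2006, Venerucci2015]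

Barriers (technique_class: hida-families two-variable-p-adic-l euler-systems): - technique_class: hida-families two-variable-p-adic-l euler-systems
- Literature.Barriers.BirchSwinnertonDyer.PAdicHeightBarrier: partly evaded, partly the bet. In
analytic rank ONE the total order at (2,1) is again Schneider's conjecture (the FE forces the linear
form ∝ (σ − κ/2), whose one free coefficient is L_p'(E,1) ∝ h_p(P)) — so EdgeDecay is RESTRICTED to
r_an ≥ 2 and rank ≤ 1 goes through the Gross–Zagier–Kolyvagin leaf; in rank ≥ 2 the escaping
hypothesis is the PENCIL: n_p = r needs (rank 2) (Pf⟨P,Q⟩^Nek, det⟨,⟩^MTT) ≠ (0,0), strictly weaker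
than det⟨,⟩^MTT ≠ 0, and the weight-direction leading terms are logarithms of points
(BertoliniDarmon2007, BertoliniEtAl2022) rather than heights. It is still a p-adic non-degeneracy:
the bet is that the alternating weight pairing is the accessible member.
- Literature.Barriers.BirchSwinnertonDyer.PAdicFunctionalEquationSeesOnlyParity: applies and is not
used — the two-variable functional equation (k,s) ↔ (k,k−s) only forces the factor (σ − κ/2) for odd
r (GreenbergStevens1993 p. 413; 2001 Thm A); EdgeDecay is a statement about VALUES (edge critical
values), not signs, exactly what the barrier leaves open.
- Literature.Barriers.BirchSwinnertonDyer.ExceptionalZeroBarrier: evaded by hypothesis — every item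
carries good ORDINARY reduction at p (¬ p ∣ a_p) and a_p² ≢ 1 (no improved-Euler-factor zero on the
vertical line); split multiplicative p, where n_p = r + 1 with 𝓛_p(E) ≠ 0 known (the barrier's
narrow form as a RESOURCE, 2001

History (route lifecycle, newest last):
- 2026-08-17T08:35:45Z · rev 6: dropped PAdicOrderMainConjectureR5 — route-repair (rrepair-809d48bf, unused-crux, gen 1): DROP PAdicOrderMainConjectureR5 (stmt-15418, cyclotomic IMC = BCS2025 Thm 1.1.2(a), Iff.rfl-equal to the ve (planner-rrepair-BirchSwinnertonDyer-TangentCon-809d48bf-0)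

sub-problem: BirchSwinnertonDyer · status: open · opened planner-plan-lens3-BirchSwinnertonDyer-resurrect-0 2026-08-17T02:03:50Z · rev 7 · ledger route-BirchSwinnertonDyer-TangentCone
GENERATED by the gate from the ledger (D-0016/17). Provers cite these decls: `theorem foo : Summit.BirchSwinnertonDyer.BirchSwinnertonDyer.Theses.TangentCone.<Decl> := …` in Summits/BirchSwinnertonDyer/BirchSwinnertonDyer/Theorems/<Name>.lean.
-/

namespace Summit.BirchSwinnertonDyer.BirchSwinnertonDyer.Theses.TangentCone

open scoped BigOperators Topology Manifold Classical MeasureTheory ProbabilityTheory Matrix InnerProductSpace ComplexConjugate ContinuousMap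
open Filter Set Function TopologicalSpace MeasureTheory

attribute [summit_statement] _root_.BirchSwinnertonDyer

open Literature

/-- item stmt-BirchSwinnertonDyer-17608 · crux · rank 2 · open · by planner
why it might fail: Given the two-variable IMC it is ⟺ Ш[p^∞]-cotorsion ∧ non-degeneracy of SOME pencil member κ⟨,⟩^Nek+(σ−κ/2)⟨,⟩^MTT at one admissible p — a Schneider-type (p-adic transcendence) statement, known in no rank ≥ 2 case; a side condition ((Br), depth, slope parity) may be mis-typed.
sources: GreenbergStevens1993, Delbourgo2008, Venerucci2015, BertoliniDarmon2007, Ochiai2006, EmertonPollackWeston2005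
[crux] EDGE DECAY ≤ ANALYTIC RANK (2001 TEO_p, period-free). For every elliptic E/ℚ (globally
minimal W) with ord_(s=1) L(E,s) ≥ 2 and at least one big-image good ordinary prime ≥ 5: there are
an admissible p (p ≥ 5 good ordinary, a_p² ≢ 1 mod p, ρ̄_(E,p) surjective, (Br): every ordinary
p-adic eigensystem of a weight-2 newform of level M ∣ N_E·p congruent to E away from N_E·p is f_E's
own) and a slope a/b ∈ [0, 1/2) such that for every J there is C with: for every m there are k ≡ 2
mod 2b(p−1)p^m, k ≥ 2J+3, the point s = 1 + a(k−2)/b, an ordinary newform g ∈ S_k(Γ₀(N_E)) with a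
p-adic embedding ι of its coefficient field congruent to E (the Hida-branch member), and for every
odd j ∈ [3, 2J+1] the ratio R = Λ(g,s)/Λ(g,j) ∈ K_g satisfies ‖ι R‖·p^(r_an·(m+1)+C) ≥ 1 — the
two-variable p-adic L-function of the Hida family vanishes at (2,1) to total order ≤ r_an
(Greenberg–Stevens predict = r_an). [difficulty: open-problem] -/
@[route_item "route-BirchSwinnertonDyer-TangentCone", crux]
def EdgeDecay : Prop :=
  ∀ (W : WeierstrassCurve ℚ) [W.IsElliptic] [W.IsGloballyMinimal], 2 ≤ W.analyticRank → (∃ (p₀ : ℕ) (_ : Fact p₀.Prime), 5 ≤ p₀ ∧ W.HasGoodReductionAtPrime p₀ ∧ ¬ (p₀ : ℤ) ∣ W.frobeniusTrace p₀ ∧ W.HasSurjectiveModNGaloisRep p₀) → ∃ (_ : NeZero (W.conductorNorm ℤ)) (p : ℕ) (_ : Fact p.Prime), 5 ≤ p ∧ W.HasGoodReductionAtPrime p ∧ ¬ (p : ℤ) ∣ W.frobeniusTrace p ∧ ¬ (p : ℤ) ∣ (W.frobeniusTrace p) ^ 2 - 1 ∧ W.HasSurjectiveModNGaloisRep p ∧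 (∀ (M : ℕ) (_ : NeZero M) (g : CuspForm (CongruenceSubgroup.Gamma0 M) 2) (ι : Literature.NumberTheory.EllipticCurves.ModularForms.coeffField g →+* PadicAlgCl p), M ∣ W.conductorNorm ℤ * p → Literature.NumberTheory.EllipticCurves.ModularForms.IsNewform0 g → ‖ι ⟨(UpperHalfPlane.qExpansion 1 ⇑g).coeff p, Literature.NumberTheory.EllipticCurves.ModularForms.coeff_mem_coeffField g p⟩‖ = 1 → (∀ ℓ : ℕ, ℓ.Prime → ¬ ℓ ∣ W.conductorNorm ℤ * p → ‖ι ⟨(UpperHalfPlane.qExpansion 1 ⇑g).coeff ℓ, Literature.NumberTheory.EllipticCurves.ModularForms.coeff_mem_coeffField g ℓ⟩ - ((W.frobeniusTrace ℓ : ℤ) : PadicAlgCl p)‖ < 1) → M = W.conductorNorm ℤ ∧ ∀ n : ℕ, (UpperHalfPlane.qExpansion 1 ⇑g).coeff n = ((W.LFunction n : ℤ) : ℂ)) ∧ ∃ (a b : ℕ), 0 < b ∧ 2 * a < b ∧ ∀ J : ℕ, ∃ C : ℕ, ∀ m : ℕ, ∃ (k : ℤ) (g : CuspForm (CongruenceSubgroup.Gamma0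 (W.conductorNorm ℤ)) k) (ι : Literature.NumberTheory.EllipticCurves.ModularForms.coeffField g →+* PadicAlgCl p) (s : ℕ), (2 * b * (p - 1) * p ^ m : ℤ) ∣ (k - 2) ∧ (2 * J + 3 : ℤ) ≤ k ∧ (b : ℤ) * ((s : ℤ) - 1) = a * (k - 2) ∧ Literature.NumberTheory.EllipticCurves.ModularForms.IsNewform0 g ∧ ‖ι ⟨(UpperHalfPlane.qExpansion 1 ⇑g).coeff p, Literature.NumberTheory.EllipticCurves.ModularForms.coeff_mem_coeffField g p⟩‖ = 1 ∧ (∀ ℓ : ℕ, ℓ.Prime → ¬ ℓ ∣ W.conductorNorm ℤ * p → ‖ι ⟨(UpperHalfPlane.qExpansion 1 ⇑g).coeff ℓ, Literature.NumberTheory.EllipticCurves.ModularForms.coeff_mem_coeffField g ℓ⟩ - ((W.frobeniusTrace ℓ : ℤ) : PadicAlgCl p)‖ < 1) ∧ ∀ (j : ℕ), Odd j → 3 ≤ j → j ≤ 2 * J + 1 → ∃ hR : (∫ t in Set.Ioi (0 : ℝ), ((t : ℂ) ^ (s - 1)) * g (UpperHalfPlane.ofComplex ((t : ℂ) * Complex.I)))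 / (∫ t in Set.Ioi (0 : ℝ), ((t : ℂ) ^ (j - 1)) * g (UpperHalfPlane.ofComplex ((t : ℂ) * Complex.I))) ∈ Literature.NumberTheory.EllipticCurves.ModularForms.coeffField g, 1 ≤ ‖ι ⟨_, hR⟩‖ * (p : ℝ) ^ (W.analyticRank * (m + 1) + C)

/-- item stmt-BirchSwinnertonDyer-17609 · crux · rank 3 · open · by planner
why it might fail: Ochiai's divisibility needs a UNIT transvection in im ρ_𝕋: printed from a Steinberg prime ℓ, p ∤ ord_ℓ Δ (2001 Thm C (H4)); for integral-j curves only big-image theorems (Hida 2015), removal unproved; control/pseudo-null at (2,1) and the typed (Br)/depth/parity side conditions may be mis-stated.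
sources: Ochiai2005, Ochiai2006, GreenbergStevens1993, Delbourgo2008, Nekovar2006, EmertonPollackWeston2005
[crux] EDGE VALUES CAP THE SELMER CORANK (2001 two-variable-tangent-cone Thm B + Thm C =
unpublished-internal-dependency, declared as a crux; ratio form). For every elliptic E/ℚ (globally
minimal W), every admissible p as in EdgeDecay and every slope a/b < 1/2 there are J, C such that
for every k ≡ 2 mod 2b(p−1) with k ≥ 2J+3, s = 1 + a(k−2)/b, every ordinary newform g ∈ S_k(Γ₀(N_E))
with a congruent p-adic embedding ι (the branch member, by (Br)), SOME odd j ∈ [3, 2J+1] has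
‖ι(Λ(g,s)/Λ(g,j))‖·p^(s_p·(1+v_p(k−2))) ≤ p^C, s_p = corank_ℤ_p Sel_p∞(E/ℚ): the edge ratios decay
at least at rate s_p. Intended proof: Greenberg–Stevens/Kitagawa two-variable L_p of the branch (𝕋_𝔪
≅ Λ by (Br)); interpolation at (k,s) and (k,j) with the SAME p-adic period (ratio kills periods and
Λ-adic units; vertical divisors cancel); Ochiai's divisibility char X ∣ L_p and control s_p ≤ n_p
(2001 Thm C: (H1), (Br), −1 ∈ im ρ̄, transvection); n_p ≤ order along the curve (1+σ) = (1+κ)^λ;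
order ⇒ valuation growth ≥ n_p·(1+v_p(k−2)) + μ uniformly (Weierstrass preparation); reference j by
compactness of weight space (the σ_j are infinitely many distinct points of the closed disc, so
max_j≤2J+1 |G₁(κ,σ_j)| is bou -/
@[route_item "route-BirchSwinnertonDyer-TangentCone", crux]
def EdgeCap : Prop :=
  ∀ (W : WeierstrassCurve ℚ) [W.IsElliptic] [W.IsGloballyMinimal] (_ : NeZero (W.conductorNorm ℤ)) (p : ℕ) [Fact p.Prime], 5 ≤ p → W.HasGoodReductionAtPrime p → ¬ (p : ℤ) ∣ W.frobeniusTrace p → ¬ (p : ℤ) ∣ (W.frobeniusTrace p) ^ 2 - 1 → W.HasSurjectiveModNGaloisRep p → (∀ (M : ℕ) (_ : NeZero M) (g : CuspForm (CongruenceSubgroup.Gamma0 M) 2) (ι : Literature.NumberTheory.EllipticCurves.ModularForms.coeffField g →+* PadicAlgCl p), M ∣ W.conductorNorm ℤ * p → Literature.NumberTheory.EllipticCurves.ModularForms.IsNewform0 g → ‖ι ⟨(UpperHalfPlane.qExpansion 1 ⇑g).coeff p, Literature.NumberTheory.EllipticCurves.ModularForms.coeff_mem_coeffField g p⟩‖ =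 1 → (∀ ℓ : ℕ, ℓ.Prime → ¬ ℓ ∣ W.conductorNorm ℤ * p → ‖ι ⟨(UpperHalfPlane.qExpansion 1 ⇑g).coeff ℓ, Literature.NumberTheory.EllipticCurves.ModularForms.coeff_mem_coeffField g ℓ⟩ - ((W.frobeniusTrace ℓ : ℤ) : PadicAlgCl p)‖ < 1) → M = W.conductorNorm ℤ ∧ ∀ n : ℕ, (UpperHalfPlane.qExpansion 1 ⇑g).coeff n = ((W.LFunction n : ℤ) : ℂ)) → ∀ (a b : ℕ), 0 < b → 2 * a < b → ∃ (J C : ℕ), ∀ (k : ℤ) (g : CuspForm (CongruenceSubgroup.Gamma0 (W.conductorNorm ℤ)) k) (ι : Literature.NumberTheory.EllipticCurves.ModularForms.coeffField g →+* PadicAlgCl p) (s : ℕ), (2 * b * (p - 1) : ℤ) ∣ (k - 2) → (2 * J + 3 : ℤ) ≤ k → (b : ℤ) * ((s : ℤ) - 1) = a * (k - 2) → Literature.NumberTheory.EllipticCurves.ModularForms.IsNewform0 g → ‖ι ⟨(UpperHalfPlane.qExpansion 1 ⇑g).coeff p, Literature.NumberTheory.EllipticCurves.ModularForms.coeff_mem_coeffField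 g p⟩‖ = 1 → (∀ ℓ : ℕ, ℓ.Prime → ¬ ℓ ∣ W.conductorNorm ℤ * p → ‖ι ⟨(UpperHalfPlane.qExpansion 1 ⇑g).coeff ℓ, Literature.NumberTheory.EllipticCurves.ModularForms.coeff_mem_coeffField g ℓ⟩ - ((W.frobeniusTrace ℓ : ℤ) : PadicAlgCl p)‖ < 1) → ∃ (j : ℕ), Odd j ∧ 3 ≤ j ∧ j ≤ 2 * J + 1 ∧ ∀ hR : (∫ t in Set.Ioi (0 : ℝ), ((t : ℂ) ^ (s - 1)) * g (UpperHalfPlane.ofComplex ((t : ℂ) * Complex.I))) / (∫ t in Set.Ioi (0 : ℝ), ((t : ℂ) ^ (j - 1)) * g (UpperHalfPlane.ofComplex ((t : ℂ) * Complex.I))) ∈ Literature.NumberTheory.EllipticCurves.ModularForms.coeffField g, ‖ι ⟨_, hR⟩‖ * (p : ℝ) ^ (W.selmerCorank p * (1 + padicValInt p (k - 2))) ≤ (p : ℝ) ^ C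

/-- item stmt-BirchSwinnertonDyer-0131 · crux · rank 4 · open · by planner
why it might fail: Theorem for r_an ≤ 3 (BCS2025 1.1.2, BurungaleEtAl2026 Cor 1, p-parity); OPEN from r_an = 4: needs Selmer classes out of high-order vanishing; the tangent cone gives only UPPER bounds.
sources: BurungaleEtAl2026, SkinnerUrban2014, Kato2004Asterisque, arXiv:2412.20078
Lower bound half of p^∞-Selmer BSD under Skinner2020-type hypotheses. Known when r_an ≤ 3
(SkinnerUrban2014 Thm 2 corank-0 converse, Skinner2020 Thm A corank-1 converse, p-parity
DokchitserDokchitser2010). imports: Summits.BirchSwinnertonDyer.Statement,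
Literature.NumberTheory.EllipticCurves.{Selmer,Sha,Heights,GaloisAction,Tamagawa,BSDInvariants}
(routes/Sketch.lean, lean check rc 0 on 2026-08-13). -/
@[route_item "route-BirchSwinnertonDyer-TangentCone", crux]
def SelmerRankLB : Prop :=
  ∀ (W : WeierstrassCurve ℚ) [W.IsElliptic] [W.IsGloballyMinimal] (p : ℕ) [Fact p.Prime], 5 ≤ p → W.HasGoodReductionAtPrime p → ¬ (p : ℤ) ∣ W.frobeniusTrace p → W.HasSurjectiveModNGaloisRep p → W.analyticRank ≤ W.selmerCorank p

/-- item stmt-BirchSwinnertonDyer-0132 · crux · rank 5 · open · by planner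
why it might fail: Known only for r_an ≤ 1 (Kolyvagin1990, Kato2004Asterisque Thm 14.2); for r_an ≥ 2 nothing excludes an infinitely divisible element of Ш at every p; far stronger than the one-prime cotorsion the glue consumes.
sources: Kolyvagin1990, Kato2004Asterisque, GreenbergLNM1716
p-primary Tate–Shafarevich finiteness (weaker than Literature.BSD.ShaFiniteConjecture, prime by
prime). Known when r_an ≤ 1 (Kolyvagin1990 Thm A; Kato2004 Thm 14.2 =
Literature.NumberTheory.EllipticCurves.kato_finite_of_L_one_ne_zero for r_an = 0). Tate1974 §1.
imports: Summits.BirchSwinnertonDyer.Statement,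
Literature.NumberTheory.EllipticCurves.{Selmer,Sha,Heights,GaloisAction,Tamagawa,BSDInvariants}
(routes/Sketch.lean, lean check rc 0 on 2026-08-13). -/
@[route_item "route-BirchSwinnertonDyer-TangentCone", crux]
def SelmerRankShaPFinite : Prop :=
  ∀ (W : WeierstrassCurve ℚ) [W.IsElliptic] (p : ℕ) [Fact p.Prime], Finite ↥(AddCommGroup.primaryComponent W.sha p)

/-- item stmt-BirchSwinnertonDyer-18086 · crux · rank 8 · open · by planner
why it might fail: Selmer-rank BSD for CM curves is open once min(corank_p, r_an) ≥ 2: Rubin's two-variable IMC bounds corank_p only by the order of a Katz p-adic L, whose comparison with r_an needs a non-degenerate CM p-adic height (Bertrand1982 = rank 1); r_an ≤ corank_p beyond p-parity has no engine.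
sources: Rubin1991MainConj (K. Rubin, Invent. Math. 103 (1991): two-variable main conjecture for CM curves), CoatesWiles1977; Rubin1987Sha (r_an = 0 slice), arXiv:2506.03465 (Burungale–Tian, Ann. of Math. 203 (2026) Thm 1.1: CM rank-0 p-converse) = Literature.NumberTheory.EllipticCurves.burungaleTian_analyticRank_eq_zero_of_selmerCorank_eq_zero_of_hasCM, doi:10.1007/s00222-019-00929-7 (Burungale–Tian, Invent. Math. 220 (2020): CM rank-1 p-converse, p > 3 good ordinary) = Literature.NumberTheory.EllipticCurves.burungaleTian_analyticRank_eq_one_of_selmerCorank_eq_one_of_hasCM, DokchitserDokchitserAnnals2010, Thm 1.4 (p-parity) = Literature.NumberTheory.EllipticCurves.selmerCorank_mod_two_eq, doi:10.5802/aif.2206 (Agboola–Howard, anticyclotomic Iwasawa theory of CM curves)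
[crux] CM SECTOR of SelmerRankSmallImage (stmt-BirchSwinnertonDyer-14418) — Selmer-rank BSD for
elliptic curves E/ℚ WITH COMPLEX MULTIPLICATION (globally minimal W, W.HasCM) at every prime p ≥ 5
of good ordinary reduction (the primes split in the CM field): corank_{ℤ_p} Sel_{p^∞}(E/ℚ) =
ord_{s=1} L(E,s). Filed by the route-choice planner (unit
rchoice-Summits-BirchSwinnertonDyer-Bi-aee6ff5b, 2026-08-17; payload.route_choice on
Theorems/TangentConeSelmerRankSmallImageReduction.lean, p146239, whose hypothesis
burungaleTian_analyticRank_eq_zero_of_selmerCorank_eq_zero_of_hasCM is an XL-apex non-crux fact) as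
the RE-ROUTE: with Serre's open image theorem PROVED in tree
(Literature.NumberTheory.EllipticCurves.serre_open_image_holds) every non-CM curve has a big-image
good ordinary prime q ≥ 5 (Theorems.exists_goodOrdinary_surjective_of_not_hasCM, landed), where this
route's own big-image items give corank_q = r_an, and the route's Ш item(s) transfer the corank to
any other prime through Greenberg's proved identity corank Sel_{p^∞} = rank + corank Ш[p^∞]; hence
the small-image crux costs, beyond items the route already carries, EXACTLY this statement and
NOTHING from the literature — the -/
@[route_item "route-BirchSwinnertonDyer-TangentCone", crux]
def SelmerRankCM : Prop :=
  ∀ (W : WeierstrassCurve ℚ) [W.IsElliptic] [W.IsGloballyMinimal] (p : ℕ) [Fact p.Prime], 5 ≤ p → W.HasGoodReductionAtPrime p → ¬ (p : ℤ) ∣ W.frobeniusTrace p → W.HasCM → W.selmerCorank p = W.analyticRank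

/-- item stmt-BirchSwinnertonDyer-17610 · crux (kind.auto-crux: conjecture-grade) · rank 9 · open · by planner
why it might fail: auto-crux — conjecture-grade statement (docstring avows it ('conjecture')); it is open, so it may simply be false
sources: GrossZagier1986, Kolyvagin1990, Darmon2004
[support] literature leaf (Gross–Zagier–Kolyvagin, Darmon2004 Thm 3.22): ord_(s=1) L(E,s) ≤ 1 ⇒
rank_ℤ E(ℚ) = ord_(s=1) L(E,s) and Ш(E/ℚ) finite — verbatim the body of the tree fact
Literature.NumberTheory.EllipticCurves.rank_eq_analyticRank_of_analyticRank_le_one; analytic rank ≤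
1 never enters EdgeDecay (where it would be Schneider's conjecture in rank one). [difficulty: XL] -/
@[route_item "route-BirchSwinnertonDyer-TangentCone", crux]
def RankLeOne : Prop :=
  ∀ (W : WeierstrassCurve ℚ) [W.IsElliptic] (h : W.analyticRank ≤ 1), W.mordellWeilRank = W.analyticRank ∧ Finite W.sha

/-- item stmt-BirchSwinnertonDyer-14418 · support · rank 6 · open · by planner
why it might fail: Open from min(corank, r_an) ≥ 2 as UB/LB; Eisenstein p has IMC/μ = 0 only in the GreenbergVatsal2000 / CGLS cases, CM has Rubin's two-variable IMC but no link to r_an ≥ 2.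
sources: GreenbergLNM1716, Serre1972, SkinnerUrban2014, BurungaleEtAl2026
[crux] Complementary (small-image) sector of p^∞-Selmer BSD at ONE good ordinary prime: for E/ℚ
(globally minimal W) and p ≥ 5 of good ordinary reduction whose mod-p representation ρ̄_{E,p} is NOT
surjective — every such p for a CM curve; for a non-CM curve the finitely many exceptional p
(Serre1972 §4.2 Thm 2), in particular the Eisenstein primes of a rational p-isogeny (Mazur1978 Thm
1: p ∈ {5,7,11,13,17,19,37,43,67,163}) and normaliser-of-Cartan images — corank_{ℤ_p} Sel_{p^∞}(E/ℚ)
= ord_{s=1} L(E,s). Together with UB ∧ LB (surjective image) this is Selmer-rank BSD at EVERY good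
ordinary p ≥ 5, which is what the glue SelmerRankCruxesToThesis consumes at the prime supplied by
the PROVED tree theorem WeierstrassCurve.exists_good_ordinary_prime_holds; filed (route-choice
repair 2026-08-16) instead of a Serre-open-image prime-supply item so that the route's
used-constants cone stays proved to Mathlib (Literature…serre_open_image is cite-only). Known:
p-parity for all E/ℚ and all p (DokchitserDokchitserAnnals2010 Thm 1.4 =
Literature.NumberTheory.EllipticCurves.selmerCorank_mod_two_eq); corank 0 ⇔ r_an 0 and corank 1 ⇔
r_an 1 in large sub-cases (irreducible non-surjective image: Buru -/
@[route_item "route-BirchSwinnertonDyer-TangentCone", crux]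
def SelmerRankSmallImage : Prop :=
  ∀ (W : WeierstrassCurve ℚ) [W.IsElliptic] [W.IsGloballyMinimal] (p : ℕ) [Fact p.Prime], 5 ≤ p → W.HasGoodReductionAtPrime p → ¬ (p : ℤ) ∣ W.frobeniusTrace p → ¬ W.HasSurjectiveModNGaloisRep p → W.selmerCorank p = W.analyticRank

/-- item stmt-BirchSwinnertonDyer-17959 · support · rank 9 · closed · proved by Summit.BirchSwinnertonDyer.BirchSwinnertonDyer.Theorems.frozenTwin_serrePrimeSupply_proof @ 95fa61c19ef9 (prover) · by planner
[support] SERRE PRIME SUPPLY (literature leaf, PROVED in tree; closable today by a one-line Theorems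
file): every NON-CM elliptic curve E/ℚ (global minimal model W) has a prime p ≥ 5 of good ORDINARY
reduction at which the mod-p Galois representation is SURJECTIVE — Serre 1972 §4.2 Thm 2 (open
image) + infinitely many good ordinary primes (Serre 1981 §8). Tree proof:
Summit.BirchSwinnertonDyer.BirchSwinnertonDyer.Theorems.exists_goodOrdinary_surjective_of_not_hasCM
(Theorems/TangentConeSelmerRankSmallImageReduction.lean, p146239) =
Literature.NumberTheory.EllipticCurves.serre_open_image_holds (SerreOpenImageFinalProofs) +
WeierstrassCurve.infinite_goodOrdinaryPrimes_holds (SupersingularDensityProofs); close it with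
`theorem serrePrimeSupply : <Route>.SerrePrimeSupply := fun W _ _ h =>
Summit.BirchSwinnertonDyer.BirchSwinnertonDyer.Theorems.exists_goodOrdinary_surjective_of_not_hasCM
W h`. WHY AN ITEM (route-choice repair rchoice-de55961e, 2026-08-17): it is the PRIME SWITCH that
lets the deciding theorem consume the CM crux SelmerRankCM (stmt-BirchSwinnertonDyer-18086) instead
of SelmerRankSmallImage (stmt-14418, now support): non-CM curve → this big-image prime and the
route's own -/
@[route_item "route-BirchSwinnertonDyer-TangentCone"]
def SerrePrimeSupply : Prop :=
  ∀ (W : WeierstrassCurve ℚ) [W.IsElliptic] [W.IsGloballyMinimal], ¬ W.HasCM → ∃ (p : ℕ) (_ : Fact p.Prime), 5 ≤ p ∧ W.HasGoodReductionAtPrime p ∧ ¬ (p : ℤ) ∣ W.frobeniusTrace p ∧ W.HasSurjectiveModNGaloisRep p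

/-- item stmt-BirchSwinnertonDyer-17611 · assembly · rank 1 · closed · proved by Summit.BirchSwinnertonDyer.BirchSwinnertonDyer.Theorems.tangentCone_assembly_proof @ f136f8c0f68f (prover) · by planner
sources: GreenbergLNM1716, GreenbergStevens1993
[assembly] EdgeDecay → EdgeCap → SelmerRankLB → SelmerRankShaPFinite → SelmerRankSmallImage →
RankLeOne → BirchSwinnertonDyer. -/
@[route_item "route-BirchSwinnertonDyer-TangentCone"]
def Assembly : Prop :=
  EdgeDecay → EdgeCap → SelmerRankLB → SelmerRankShaPFinite → SelmerRankSmallImage → RankLeOne → _root_.BirchSwinnertonDyer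

/-! D-0027 §2.1 — DECIDING THEOREM (planner-authored via `route open/edit --closes-file`; by planner-plan-lens3-BirchSwinnertonDyer-resurrect-0 2026-08-17T02:03:50Z):
its hypotheses are this route's items and its conclusion the sub-problem Statement (glue_lint), and it elaborates with this file. -/

@[closes "route-BirchSwinnertonDyer-TangentCone"] theorem closes (hE : EdgeDecay) (hC : EdgeCap) (hLB : SelmerRankLB) (hSha : SelmerRankShaPFinite)
    (hSI : SelmerRankSmallImage) (hR1 : RankLeOne) : _root_.BirchSwinnertonDyer := by
  -- Greenberg's corank identity (proved in tree) and shaCorank = 0 for finite Ш[p^∞] (proved in tree)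
  have hId : ∀ (W : WeierstrassCurve ℚ), W.selmerCorank_eq_mordellWeilRank_add :=
    fun W => W.selmerCorank_eq_mordellWeilRank_add_holds
  have hZ : ∀ (W : WeierstrassCurve ℚ) [W.IsElliptic] (p : ℕ) [Fact p.Prime],
      Finite ↥(AddCommGroup.primaryComponent W.sha p) → W.shaCorank p = 0 :=
    Literature.BSD.shaCorank_eq_zero_of_finite
  -- (T1) the Mordell–Weil rank is an isomorphism invariant (AEC III.3.1(b); `VariableChangePoints`)
  have hMW : ∀ (W : WeierstrassCurve ℚ) (C : WeierstrassCurve.VariableChange ℚ),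
      (C • W).mordellWeilRank = W.mordellWeilRank := fun W C =>
    @WeierstrassCurve.VariableChange.finrank_point_variableChange ℚ _ W C (Classical.decEq ℚ)
  -- (T2) the local Euler factor is an isomorphism invariant (AEC VII.1.3(b), VII.2, VII.5.1, C §16)
  have hloc : ∀ (R : Type) [CommRing R] [IsDomain R] [IsDiscreteValuationRing R]
      (K : Type) [Field K] [Algebra R K] [IsFractionRing R K]
      (W : WeierstrassCurve K) [W.IsElliptic] (C : WeierstrassCurve.VariableChange K),
      (C • W).localEulerFactor R = W.localEulerFactor R := by
    intro R _ _ _ K _ _ _ W _ C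
    obtain ⟨D, hD⟩ : ∃ D : WeierstrassCurve.VariableChange K,
        (C • W).minimal R = D • W.minimal R :=
      ⟨((C • W).exists_isMinimal R).choose * C * ((W.exists_isMinimal R).choose)⁻¹, by
        rw [WeierstrassCurve.minimal, WeierstrassCurve.minimal, mul_smul, mul_smul, inv_smul_smul]⟩
    haveI hE' : (W.minimal R).IsElliptic := by rw [WeierstrassCurve.minimal]; infer_instance
    have hΔ : (W.minimal R).Δ ≠ 0 := (W.minimal R).isUnit_Δ.ne_zero
    have hgood : ((C • W).minimal R).HasGoodReduction R ↔ (W.minimal R).HasGoodReduction R := by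
      rw [WeierstrassCurve.hasGoodReduction_iff, WeierstrassCurve.hasGoodReduction_iff,
        WeierstrassCurve.valuation_Δ_eq_of_isMinimal_of_eq_smul R hD]
      exact and_congr_left' ⟨fun _ => inferInstance, fun _ => inferInstance⟩
    have hcard : Nat.card (((C • W).minimal R).reduction R).toAffine.Point =
        Nat.card ((W.minimal R).reduction R).toAffine.Point := by
      obtain ⟨E, hE⟩ := WeierstrassCurve.exists_reduction_eq_smul R hD hΔ
      rw [hE]
      exact WeierstrassCurve.natCard_point_smul _ _
    have hpoly : (C • W).localPolynomial R = W.localPolynomial R := by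
      classical
      unfold WeierstrassCurve.localPolynomial
      simp only [hgood, hcard,
        WeierstrassCurve.hasSplitMultiplicativeReduction_iff_of_isMinimal_of_eq_smul R hD hΔ,
        WeierstrassCurve.hasMultiplicativeReduction_iff_of_isMinimal_of_eq_smul R hD hΔ]
    simp only [WeierstrassCurve.localEulerFactor, WeierstrassCurve.localPowerSeries, hpoly]
  -- (T3) hence the analytic rank is an isomorphism invariant (AEC App. C §16)
  have hAn : ∀ (W : WeierstrassCurve ℚ) [W.IsElliptic] (C : WeierstrassCurve.VariableChange ℚ),
      (C • W).analyticRank = W.analyticRank := by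
    intro W _ C
    have hL : (C • W).LFunction = W.LFunction := by
      unfold WeierstrassCurve.LFunction
      congr 1
      funext v
      simp only [WeierstrassCurve.baseChange, ← WeierstrassCurve.map_variableChange]
      exact hloc _ _ _ _
    have hLS : (C • W).LSeries = W.LSeries := by
      funext s
      simp only [WeierstrassCurve.LSeries, hL]
    have hEC : (C • W).entireContinuations = W.entireContinuations := by
      simp only [WeierstrassCurve.entireContinuations, hLS]
    have hEL : (C • W).entireLFunction = W.entireLFunction := by
      unfold WeierstrassCurve.entireLFunction
      rw [hEC, hLS]
    simp only [WeierstrassCurve.analyticRank, hEL]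
  -- Selmer-rank BSD at ONE prime on a global minimal model of analytic rank ≥ 2
  have hsel : ∀ (V : WeierstrassCurve ℚ) [V.IsElliptic] [V.IsGloballyMinimal], 2 ≤ V.analyticRank →
      ∃ (p : ℕ) (_ : Fact p.Prime), V.selmerCorank p = V.analyticRank := by
    intro V _ _ h2
    obtain ⟨p₀, hp₀, h5, hgood, hord⟩ := WeierstrassCurve.exists_good_ordinary_prime_holds V
    by_cases hsurj : V.HasSurjectiveModNGaloisRep p₀
    · -- the tangent-cone prime: EdgeDecay supplies (p, Br, slope a/b), EdgeCap the matching lower bound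
      obtain ⟨hN, p, hp, h5', hgood', hord', hna, hsurj', hBr, a, b, hb, hab, hJ⟩ :=
        hE V h2 ⟨p₀, hp₀, h5, hgood, hord, hsurj⟩
      obtain ⟨J, C₁, hcap⟩ := hC V hN p h5' hgood' hord' hna hsurj' hBr a b hb hab
      obtain ⟨C₂, hm⟩ := hJ J
      have hp1 : (1 : ℝ) < (p : ℝ) := by exact_mod_cast hp.out.one_lt
      have hp0 : (0 : ℝ) < (p : ℝ) := lt_trans zero_lt_one hp1
      have key : ∀ m : ℕ, V.selmerCorank p * (1 + m) ≤ V.analyticRank * (m + 1) + (C₁ + C₂) := by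
        intro m
        obtain ⟨k, g, ι, s, hdiv, hkJ, hs, hnew, hordg, hcong, hall⟩ := hm m
        have hdiv' : (2 * b * (p - 1) : ℤ) ∣ (k - 2) := (Dvd.intro _ rfl).trans hdiv
        obtain ⟨j, hjodd, hj3, hjJ, hcapj⟩ := hcap k g ι s hdiv' hkJ hs hnew hordg hcong
        obtain ⟨hR, hlow⟩ := hall j hjodd hj3 hjJ
        have hup := hcapj hR
        -- m ≤ v_p(k - 2)
        have hk0 : (k - 2) ≠ 0 := by omega
        have hpm : ((p : ℤ) ^ m) ∣ (k - 2) := (Dvd.intro_left _ rfl).trans hdiv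
        have hmv : m ≤ padicValInt p (k - 2) := by
          rcases (padicValInt_dvd_iff m (k - 2)).mp hpm with h | h
          · exact absurd h hk0
          · exact h
        -- exponent bookkeeping in ℝ
        set x : ℝ := ‖ι ⟨_, hR⟩‖ with hx
        have hx0 : 0 ≤ x := norm_nonneg _
        set e₁ : ℕ := V.selmerCorank p * (1 + padicValInt p (k - 2)) with he₁
        set e₂ : ℕ := V.analyticRank * (m + 1) + C₂ with he₂
        have hpow : (p : ℝ) ^ e₁ ≤ (p : ℝ) ^ (C₁ + e₂) := by
          calc (p : ℝ) ^ e₁ = (p : ℝ) ^ e₁ * 1 := by ring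
            _ ≤ (p : ℝ) ^ e₁ * (x * (p : ℝ) ^ e₂) :=
                mul_le_mul_of_nonneg_left hlow (pow_nonneg hp0.le _)
            _ = (x * (p : ℝ) ^ e₁) * (p : ℝ) ^ e₂ := by ring
            _ ≤ (p : ℝ) ^ C₁ * (p : ℝ) ^ e₂ :=
                mul_le_mul_of_nonneg_right hup (pow_nonneg hp0.le _)
            _ = (p : ℝ) ^ (C₁ + e₂) := (pow_add (p : ℝ) C₁ e₂).symm
        have hexp : e₁ ≤ C₁ + e₂ := (pow_le_pow_iff_right₀ hp1).mp hpow
        have hmono : V.selmerCorank p * (1 + m) ≤ e₁ :=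
          Nat.mul_le_mul_left _ (by omega)
        omega
      have hUB : V.selmerCorank p ≤ V.analyticRank := by
        have hk := key (C₁ + C₂)
        by_contra hlt
        push Not at hlt
        have h1 : (V.analyticRank + 1) * (1 + (C₁ + C₂)) ≤ V.selmerCorank p * (1 + (C₁ + C₂)) :=
          Nat.mul_le_mul_right _ hlt
        nlinarith
      exact ⟨p, hp, le_antisymm hUB (hLB V p h5' hgood' hord' hsurj')⟩
    · exact ⟨p₀, hp₀, hSI V p₀ h5 hgood hord hsurj⟩
  -- rank = analytic rank on a global minimal model
  have hmin : ∀ (V : WeierstrassCurve ℚ) [V.IsElliptic] [V.IsGloballyMinimal],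
      V.mordellWeilRank = V.analyticRank := by
    intro V _ _
    by_cases h1 : V.analyticRank ≤ 1
    · exact (hR1 V h1).1
    · obtain ⟨p, hp, hcor⟩ := hsel V (by omega)
      have h3 : V.selmerCorank p = V.mordellWeilRank + V.shaCorank p := hId V p
      have h4 : V.shaCorank p = 0 := hZ V p (hSha V p)
      omega
  -- transport to an arbitrary Weierstrass model
  show ∀ W : WeierstrassCurve ℚ, W.IsElliptic → W.analyticRank = W.mordellWeilRank
  intro W hW
  obtain ⟨C, hC⟩ := WeierstrassCurve.hasGlobalMinimalModel_rat_holds W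
  have h5 := hmin (C • W)
  have h6 := hMW W C
  have h7 := hAn W C
  omega

end Summit.BirchSwinnertonDyer.BirchSwinnertonDyer.Theses.TangentCone
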